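import Literature.MathematicalPhysics.QuantumLattice.FinDimSpectrum
import Literature.MathematicalPhysics.QuantumLattice.SpinSystem
import Literature.MathematicalPhysics.QuantumLattice.HeisenbergModel
import Literature.MathematicalPhysics.QuantumLattice.LatticeTori
import Literature.MathematicalPhysics.QuantumLattice.LocalDynamics
import Literature.Probability.LatticeModels.CorrelationDecay
import Literature.Probability.LatticeModels.ReflectionPositivity
import Literature.Probability.LatticeModels.LatticeGraph
import HarnessLib

-- provenance: harness21/H21/H21/Statements/Hubbard/HeisenbergOrder.lean @ 686bf51 (interim HEAD d8f2665); M5 mechanical rewrite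
/-!
# Absence and presence of Néel order in the Heisenberg model (family `hubbard`, S12–S13)

Trunk QLatticeAQFT / family `hubbard`, statements **hubbard.S12** (Mermin–Wagner) and
**hubbard.S13** (Dyson–Lieb–Simon / Kennedy–Lieb–Shastry).

We work with the spin-`n/2` Heisenberg Hamiltonian
`H_L = J Σ_{⟨x,y⟩} 𝐒_x · 𝐒_y = heisenbergHamiltonian n (torusGraph d L) J` on the discrete torus
`(ℤ/Lℤ)^d = StatMech.TorusSite d L` (periodic boundary conditions), its finite-volume Gibbs state
`Matrix.gibbsState β H_L` and its tracial ground-state functional `Matrix.groundStateFunctional H_L`.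

* `spinSpinCorrTorus β L n J x y = ⟨𝐒_x · 𝐒_y⟩_{β, L}` (thermal) and
  `groundStateSpinCorrTorus L n J x y` (ground state), as families indexed by *all* `L : ℕ`
  (junk value `0` at `L = 0`, where the torus type `Fin d → ZMod 0 = ℤ^d` is infinite);
* the magnetisation in a symmetry-breaking field, `torusMagnetisation β L n J h`;
* **hubbard.S12** `mermin_wagner` (`d ≤ 2`, `β > 0`: no long-range order, `¬ HasTorusLRO`),
  `mermin_wagner_magnetisation` (spontaneous magnetisation `lim_{h↓0} lim_{L→∞} m = 0`) and
  `mermin_wagner_general` (any bounded finite-range `SU(2)`-invariant `LatticeInteraction`, via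
  `torusHamiltonian`);
* **hubbard.S13** `dyson_lieb_simon` (`d ≥ 3`, `S ≥ 1`, large `β`: Néel order) and
  `kennedy_lieb_shastry_ground` (ground state, `d = 3, S ≥ 1/2` or `d = 2, S ≥ 1`), together with
  the reduction `hasStaggeredEvenTorusLRO_iff_onePoint` of the two-point (`|Λ|⁻² Σ_{x,y}`) form of
  staggered long-range order to the text's one-point form `liminf |Λ|⁻¹ Σ_x (-1)^x ⟨𝐒_0 · 𝐒_x⟩ > 0`.

## Sources

* N. D. Mermin, H. Wagner, *Absence of ferromagnetism or antiferromagnetism in one- or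
  two-dimensional isotropic Heisenberg models*, Phys. Rev. Lett. 17 (1966) 1133.
* J. Fröhlich, C. Pfister, *On the absence of spontaneous symmetry breaking and of crystalline
  ordering in two-dimensional systems*, Comm. Math. Phys. 81 (1981) 277, Theorem 1.
* T. Koma, H. Tasaki, *Symmetry breaking in Heisenberg antiferromagnets*, Comm. Math. Phys. 158
  (1993) 191, Theorem 2.1 and Corollary 2.2 (at every inverse temperature `β`, the spontaneous
  (staggered) magnetisation dominates the long-range order parameter, `m_s ≥ σ`, `m_s ≥ √3 σ` under
  `SU(2)`; used to pass from the magnetisation form to the `¬ HasTorusLRO` form of Mermin–Wagner).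
* T. Koma, H. Tasaki, *Symmetry breaking and finite-size effects in quantum many-body systems*,
  J. Stat. Phys. 76 (1994) 745 (the ground-state / low-lying-states counterpart).
* F. J. Dyson, E. H. Lieb, B. Simon, *Phase transitions in quantum spin systems with isotropic and
  nonisotropic interactions*, J. Stat. Phys. 18 (1978) 335, §1 and Theorem 5.?.
* T. Kennedy, E. H. Lieb, B. S. Shastry, *Existence of Néel order in some spin-1/2 Heisenberg
  antiferromagnets*, J. Stat. Phys. 53 (1988) 1019.
* H. Tasaki, *Physics and Mathematics of Quantum Many-Body Systems* (2020), §4.4 (theorems of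
  DLS/KLS and Mermin–Wagner in textbook form).

## Mathlib / H21 status and design choices

* Mathlib has no Gibbs states of lattice Hamiltonians, no long-range order and no spin models
  (searched `gibbs`, `LongRangeOrder`, `Heisenberg`, `magnetisation|magnetization`: nothing
  relevant). Used from Mathlib: `Filter.liminf`, `Filter.atTop`, `ZMod.val`, `Finset.sum`.
  Used from H21: `heisenbergHamiltonian`, `siteSpin`, `totalSpin`, `spinDot` (`HeisenbergModel`,
  `SpinSystem`), `Matrix.gibbsState`, `Matrix.thermalCorr`, `Matrix.groundStateFunctional`
  (`FinDimSpectrum`), `torusGraph`, `TorusSite`, `Torus.proj` (`LatticeGraph`), `HasTorusLRO`,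
  `torusPullback`, `latticeStagger` (`LatticeTori`), `HasStaggeredLongRangeOrder`
  (`CorrelationDecay`), `LatticeInteraction`, `torusHamiltonian` (`LocalDynamics`).
* **LRO convention (outline §0, review F1).** Long-range order is expressed only through the
  pull-back of torus families to `Site d = ℤ^d` over `halfOpenBox`: plain LRO is
  `QLattice.HasTorusLRO`. Néel order lives on **even** tori only (the sign `(-1)^{Σ xᵢ}` is a
  consistent sublattice sign on `(ℤ/Lℤ)^d` iff `L` is even, cf. `hasStaggeredTorusLRO_iff`), and
  the texts (DLS, KLS) take `L → ∞` along even sides. Since a torus family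
  `G L : TorusSite d L → TorusSite d L → ℝ` is a dependent family, "the family `L ↦ G (2L)`" is not
  a torus family again; the subsequence is therefore taken *after* the pull-back:
  `HasStaggeredEvenTorusLRO G := HasStaggeredLongRangeOrder (fun L => halfOpenBox d (2L))
  latticeStagger (fun L => torusPullback G (2L))`, i.e. literally `HasStaggeredTorusLRO G` with its
  `liminf` restricted to the subsequence of even sides (`hasStaggeredEvenTorusLRO_iff`). No
  `HasLongRangeOrder` is ever applied to `univ : Finset (TorusSite d L)`.
* `Fintype (TorusSite d L)` needs `NeZero L`; the correlation functions are defined for all `L` by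
  a dependent `if` with junk value `0` at `L = 0` (`spinSpinCorrTorus_zero_side`), and unfolded under
  `[NeZero L]` (`spinSpinCorrTorus_of_neZero`). A `liminf` along `atTop` does not see `L = 0`.
* `⟨𝐒_x · 𝐒_y⟩` is written `Σ_α thermalCorr β H (S^α_x) (S^α_y)`; since `S^α_x` and `S^α_y` commute
  for `x ≠ y` this is the expectation of `spinDot n x y` (`spinSpinCorrTorus_eq_gibbsState_spinDot`).
* Reflection positivity (`StatMech.IsReflectionPositiveFunctional` of the Gibbs functional w.r.t.
  the torus reflections `reflectThroughSites`/`reflectBetweenSites`) is the *proof route* of S13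
  and is recorded in the docstrings, not assumed as a hypothesis.
-/

noncomputable section

open Filter Finset Matrix Complex
open Literature.MathematicalPhysics.QuantumLattice Literature.Probability.LatticeModels

namespace Literature.MathematicalPhysics.QuantumLattice

variable {d : ℕ}

/-! ### Finite-volume correlation functions on tori -/

/-- The Heisenberg Hamiltonian `H_L = J Σ_{⟨x,y⟩} 𝐒_x · 𝐒_y` of spin `n/2` on the discrete torus
`(ℤ/Lℤ)^d` with nearest-neighbour graph `StatMech.torusGraph d L` (`L ≠ 0`).
Dyson–Lieb–Simon (1978) §1; Tasaki (2020) §2.4, eq. (2.4.1). [cite: DysonLiebSimonJSP1978] -/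
abbrev heisenbergTorus (d L : ℕ) [NeZero L] (n : ℕ) (J : ℝ) : Op (TorusSite d L) (n + 1) :=
  heisenbergHamiltonian n (torusGraph d L) J

/-- The thermal spin–spin correlation `⟨𝐒_x · 𝐒_y⟩_{β,L} = Σ_α tr(e^{-βH_L} S^α_x S^α_y)/Z`
in the Gibbs state of the spin-`n/2` Heisenberg model `H_L = J Σ_{⟨x,y⟩} 𝐒_x · 𝐒_y` on the torus
`(ℤ/Lℤ)^d` (real part; the value is real since `H_L`, `S^α_x` are Hermitian and `S^α_x`, `S^α_y`
commute). **Junk value** `0` for `L = 0` (the type `TorusSite d 0 = ℤ^d` is not a finite torus).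
Dyson–Lieb–Simon (1978) §1; Mermin–Wagner (1966). [cite: DysonLiebSimonJSP1978] -/
def spinSpinCorrTorus (β : ℝ) (L n : ℕ) (J : ℝ) (x y : TorusSite d L) : ℝ :=
  if hL : L = 0 then 0
  else
    haveI : NeZero L := ⟨hL⟩
    (∑ α : Fin 3, thermalCorr β (heisenbergTorus d L n J) (siteSpin n x α) (siteSpin n y α)).re

/-- The ground-state spin–spin correlation `⟨𝐒_x · 𝐒_y⟩_{GS,L} = Σ_α tr(P₀ S^α_x S^α_y)/tr P₀`
in the tracial ground-state functional (`Matrix.groundStateFunctional`, the `β → ∞` limit of the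
Gibbs state) of the spin-`n/2` Heisenberg model on the torus `(ℤ/Lℤ)^d` (real part).
**Junk value** `0` for `L = 0`. Kennedy–Lieb–Shastry (1988) §1; Tasaki (2020) §4.4. [cite: KennedyLiebShastryJSP1988] -/
def groundStateSpinCorrTorus (L n : ℕ) (J : ℝ) (x y : TorusSite d L) : ℝ :=
  if hL : L = 0 then 0
  else
    haveI : NeZero L := ⟨hL⟩
    (∑ α : Fin 3,
      (heisenbergTorus d L n J).groundStateFunctional (siteSpin n x α * siteSpin n y α)).re

/-- At the junk side `L = 0` the thermal correlation is `0` by definition. [folklore] -/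
@[simp] theorem spinSpinCorrTorus_zero_side (β : ℝ) (n : ℕ) (J : ℝ) (x y : TorusSite d 0) :
    spinSpinCorrTorus β 0 n J x y = 0 := by
  simp [spinSpinCorrTorus]

/-- At the junk side `L = 0` the ground-state correlation is `0` by definition. [folklore] -/
@[simp] theorem groundStateSpinCorrTorus_zero_side (n : ℕ) (J : ℝ) (x y : TorusSite d 0) :
    groundStateSpinCorrTorus 0 n J x y = 0 := by
  simp [groundStateSpinCorrTorus]

/-- Unfolding `spinSpinCorrTorus` on a genuine torus (`L ≠ 0`):
`⟨𝐒_x · 𝐒_y⟩_{β,L} = re Σ_α ⟨S^α_x S^α_y⟩_β`. Dyson–Lieb–Simon (1978) §1. [cite: DysonLiebSimonJSP1978] -/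
theorem spinSpinCorrTorus_of_neZero (β : ℝ) (L : ℕ) [NeZero L] (n : ℕ) (J : ℝ)
    (x y : TorusSite d L) :
    spinSpinCorrTorus β L n J x y =
      (∑ α : Fin 3,
        thermalCorr β (heisenbergTorus d L n J) (siteSpin n x α) (siteSpin n y α)).re := by
  simp [spinSpinCorrTorus, NeZero.ne L]

/-- Unfolding `groundStateSpinCorrTorus` on a genuine torus (`L ≠ 0`).
Kennedy–Lieb–Shastry (1988) §1. [cite: KennedyLiebShastryJSP1988] -/
theorem groundStateSpinCorrTorus_of_neZero (L : ℕ) [NeZero L] (n : ℕ) (J : ℝ)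
    (x y : TorusSite d L) :
    groundStateSpinCorrTorus L n J x y =
      (∑ α : Fin 3,
        (heisenbergTorus d L n J).groundStateFunctional (siteSpin n x α * siteSpin n y α)).re := by
  simp [groundStateSpinCorrTorus, NeZero.ne L]

/-- The thermal correlation is the Gibbs expectation of the exchange operator
`spinDot n x y = 𝐒_x · 𝐒_y` (the symmetrisation in `spinDot` is immaterial since `S^α_x` and
`S^α_y` commute for `x ≠ y`, `siteSpin_commute_of_ne`). Tasaki (2020) §2.4. [cite: TasakiQMBS2020] -/
def spinSpinCorrTorus_eq_gibbsState_spinDot : Prop :=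
  ∀ (β : ℝ) (L : ℕ) [NeZero L] (n : ℕ) (J : ℝ) (x y : TorusSite d L),
    spinSpinCorrTorus β L n J x y =
      (gibbsState β (heisenbergTorus d L n J) (spinDot n x y)).re

/-- Translation invariance of the torus Gibbs state: `⟨𝐒_{x+v} · 𝐒_{y+v}⟩ = ⟨𝐒_x · 𝐒_y⟩`
(the Hamiltonian and the trace are invariant under the relabelling `x ↦ x + v` of the torus).
Dyson–Lieb–Simon (1978) §1. [cite: DysonLiebSimonJSP1978] -/
def spinSpinCorrTorus_add_right : Prop :=
  ∀ (β : ℝ) (L n : ℕ) (J : ℝ) (v x y : TorusSite d L),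
    spinSpinCorrTorus β L n J (x + v) (y + v) = spinSpinCorrTorus β L n J x y

/-- Translation invariance of the ground-state correlation on the torus.
Kennedy–Lieb–Shastry (1988) §1. [cite: KennedyLiebShastryJSP1988] -/
def groundStateSpinCorrTorus_add_right : Prop :=
  ∀ (L n : ℕ) (J : ℝ) (v x y : TorusSite d L),
    groundStateSpinCorrTorus L n J (x + v) (y + v) = groundStateSpinCorrTorus L n J x y

/-! ### Néel order along even tori -/

/-- **Staggered (Néel) long-range order along even tori.** For a torus family
`G L : (ℤ/Lℤ)^d → (ℤ/Lℤ)^d → ℝ` this is `QLattice.HasStaggeredTorusLRO G` with the `liminf`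
restricted to the subsequence of even sides `L = 2k`:
`0 < liminf_k (2k)^{-2d} Σ_{x,y ∈ (ℤ/2kℤ)^d} (-1)^x (-1)^y G (2k) x y`, implemented (outline §0 /
review F1 convention) as `StatMech.HasStaggeredLongRangeOrder` of the pull-back
`torusPullback G (2k)` to `ℤ^d` with sign `latticeStagger` over the fundamental domains
`halfOpenBox d (2k)`. Even sides are forced because the Néel sign is a consistent sublattice sign
on `(ℤ/Lℤ)^d` only for even `L` (Dyson–Lieb–Simon (1978) §1, "Λ a cube of even side";
Kennedy–Lieb–Shastry (1988) §1). [cite: DysonLiebSimonJSP1978] -/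
def HasStaggeredEvenTorusLRO (G : (L : ℕ) → TorusSite d L → TorusSite d L → ℝ) : Prop :=
  HasStaggeredLongRangeOrder (fun k => halfOpenBox d (2 * k)) latticeStagger
    (fun k => torusPullback G (2 * k))

/-- Unfolding `HasStaggeredEvenTorusLRO` to the textbook form
`0 < liminf_k L^{-2d} Σ_{x, y ∈ (ℤ/Lℤ)^d} (-1)^{Σ xᵢ} (-1)^{Σ yᵢ} G L x y` along `L = 2(k+1)`, the
torus signs being computed on canonical representatives (`ZMod.val`; for even `L` this is a
well-defined sublattice sign). The index shift `k ↦ k + 1` (so that the torus is finite) does not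
change the `liminf`. Dyson–Lieb–Simon (1978) §1, eq. (1.4). [cite: DysonLiebSimonJSP1978] -/
def hasStaggeredEvenTorusLRO_iff : Prop :=
  ∀ (G : (L : ℕ) → TorusSite d L → TorusSite d L → ℝ),
    HasStaggeredEvenTorusLRO G ↔
      0 < liminf (fun k : ℕ =>
        (∑ x : TorusSite d (2 * k + 2), ∑ y : TorusSite d (2 * k + 2),
            (-1 : ℝ) ^ (∑ i, (x i).val) * (-1) ^ (∑ i, (y i).val) * G (2 * k + 2) x y) /
          ((2 * k + 2 : ℕ) : ℝ) ^ (2 * d)) atTop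

/-- **Two-point versus one-point form of Néel order.** For a translation-invariant torus family
(`G L (x+v) (y+v) = G L x y`), staggered long-range order in the two-point form
`liminf |Λ|⁻² Σ_{x,y} (-1)^{x+y} G_L(x,y) > 0` is equivalent to the form used in the texts,
`liminf |Λ|⁻¹ Σ_x (-1)^x G_L(0,x) > 0` (`|Λ| = L^d`, `L = 2(k+1)` even): on an even torus
`(-1)^{x+v} (-1)^{y+v} = (-1)^x (-1)^y`, so `Σ_{x,y} (-1)^{x+y} G(x,y) = |Λ| Σ_z (-1)^z G(0,z)`.
Dyson–Lieb–Simon (1978) §1, eq. (1.4); Kennedy–Lieb–Shastry (1988) eq. (3). [cite: DysonLiebSimonJSP1978] -/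
def hasStaggeredEvenTorusLRO_iff_onePoint : Prop :=
  ∀ (G : (L : ℕ) → TorusSite d L → TorusSite d L → ℝ) (hG : ∀ (L : ℕ) (v x y : TorusSite d L), G L (x + v) (y + v) = G L x y),
    HasStaggeredEvenTorusLRO G ↔
      0 < liminf (fun k : ℕ =>
        (∑ x : TorusSite d (2 * k + 2), (-1 : ℝ) ^ (∑ i, (x i).val) * G (2 * k + 2) 0 x) /
          ((2 * k + 2 : ℕ) : ℝ) ^ d) atTop

/-! ### Magnetisation in a symmetry-breaking field -/

/-- The Heisenberg Hamiltonian on the torus in a uniform magnetic field `h` along the `3`-axis,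
`H_{L,h} = J Σ_{⟨x,y⟩} 𝐒_x · 𝐒_y - h Σ_x S^3_x` (`L ≠ 0`). Mermin–Wagner (1966), eq. (1);
Koma–Tasaki (1994) §1. [cite: MerminWagnerPRL1966] -/
def heisenbergTorusWithField (d L : ℕ) [NeZero L] (n : ℕ) (J h : ℝ) :
    Op (TorusSite d L) (n + 1) :=
  heisenbergTorus d L n J - (h : ℂ) • totalSpin n 2

/-- The Hamiltonian in a field is Hermitian. Mermin–Wagner (1966). [cite: MerminWagnerPRL1966] -/
theorem heisenbergTorusWithField_isHermitian (d L : ℕ) [NeZero L] (n : ℕ) (J h : ℝ) :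
    (heisenbergTorusWithField d L n J h).IsHermitian := by
  unfold heisenbergTorusWithField
  refine (heisenbergHamiltonian_isHermitian n _ J).sub (IsHermitian.smul ?_ ?_)
  · exact totalSpin_isHermitian n 2
  · rw [isSelfAdjoint_iff, Complex.star_def, conj_ofReal]

/-- The magnetisation per site `m_L(β, h) = |Λ|⁻¹ Σ_x ⟨S^3_x⟩_{β, L, h}` of the spin-`n/2`
Heisenberg model on the torus `(ℤ/Lℤ)^d` in the field `h` (real part of the Gibbs expectation of
`|Λ|⁻¹ S^3_tot`, `|Λ| = L^d`). **Junk value** `0` for `L = 0`.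
Mermin–Wagner (1966), eq. (2); Koma–Tasaki (1994) eq. (1.3). [cite: MerminWagnerPRL1966] -/
def torusMagnetisation (β : ℝ) (d L n : ℕ) (J h : ℝ) : ℝ :=
  if hL : L = 0 then 0
  else
    haveI : NeZero L := ⟨hL⟩
    (gibbsState β (heisenbergTorusWithField d L n J h)
      (((L : ℂ) ^ d)⁻¹ • totalSpin (Λ := TorusSite d L) n 2)).re

/-- Unfolding `torusMagnetisation` on a genuine torus (`L ≠ 0`). Mermin–Wagner (1966), eq. (2). [cite: MerminWagnerPRL1966] -/
theorem torusMagnetisation_of_neZero (β : ℝ) (d L : ℕ) [NeZero L] (n : ℕ) (J h : ℝ) :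
    torusMagnetisation β d L n J h =
      (gibbsState β (heisenbergTorusWithField d L n J h)
        (((L : ℂ) ^ d)⁻¹ • totalSpin (Λ := TorusSite d L) n 2)).re := by
  simp [torusMagnetisation, NeZero.ne L]

/-- The magnetisation per site is bounded by the spin, `|m_L(β, h)| ≤ n/2 = S`.
Mermin–Wagner (1966). [cite: MerminWagnerPRL1966] -/
def abs_torusMagnetisation_le : Prop :=
  ∀ (β : ℝ) (d L n : ℕ) (J h : ℝ),
    |torusMagnetisation β d L n J h| ≤ n / 2

/-! ### hubbard.S12: the Mermin–Wagner theorem -/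

/-- **hubbard.S12** (Mermin–Wagner theorem, long-range-order form). For `d ∈ {1, 2}`, every spin
`S = n/2`, every coupling `J` (ferro- or antiferromagnetic) and every temperature `β⁻¹ > 0`, the
Gibbs states of the nearest-neighbour Heisenberg model on the tori `(ℤ/Lℤ)^d` have no long-range
order: `liminf_L L^{-2d} Σ_{x,y} ⟨𝐒_x · 𝐒_y⟩_{β,L} = 0`, i.e. `¬ HasTorusLRO`. (For `d = 0` the
"torus" is a single site and `⟨𝐒_0 · 𝐒_0⟩ = S(S+1) > 0`, whence `1 ≤ d`.)
COROLLARY of two printed theorems (no single source prints this `liminf` torus form): Mermin–Wagner,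
PRL 17 (1966) 1133 — the spontaneous magnetisation `lim_{h↓0} lim_{L→∞} m_L(β,h)` vanishes for
`d ≤ 2`, `β < ∞`, by the Bogoliubov inequality, uniformly in `L` — and Koma–Tasaki, CMP 158 (1993),
Theorem 2.1 / Corollary 2.2 — at every `β` the spontaneous magnetisation dominates the long-range
order parameter, `m_s ≥ σ` with `σ² = lim |Λ|⁻² ⟨(O_Λ)²⟩_β` along any convergent subsequence
(`O_Λ = Σ_x S^{(1)}_x`; `Σ_{x,y} ⟨𝐒_x · 𝐒_y⟩ = 3 ⟨(O_Λ)²⟩` by `SU(2)` invariance of the Gibbs state),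
so `σ = 0` and `HasTorusLRO` fails.
[cite: MerminWagnerPRL1966, main result (pp. 1133–1135: bound on the magnetisation for d = 1, 2)]
[cite: KomaTasaki1993, Thm. 2.1 and Cor. 2.2 (m_s ≥ σ at every β)] -/
def mermin_wagner : Prop :=
  ∀ (d : ℕ) (hd1 : 1 ≤ d) (hd : d ≤ 2) (n : ℕ) (J β : ℝ) (hβ : 0 < β),
    ¬ HasTorusLRO (fun L x y => spinSpinCorrTorus (d := d) β L n J x y)

/-- **hubbard.S12** (Mermin–Wagner theorem, Néel form). For `d ∈ {1, 2}`, `β > 0`, the Gibbs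
states of the Heisenberg model on even tori have no staggered (Néel) long-range order either:
`liminf_k (2k)^{-2d} Σ_{x,y} (-1)^{x+y} ⟨𝐒_x · 𝐒_y⟩_{β,2k} = 0`. (On the bipartite even torus the
unitary sublattice rotation maps `J ↦ -J` for the `1`- and `2`-components only, so this is not a
formal consequence of `mermin_wagner`; it is the antiferromagnetic half of Mermin–Wagner's title.)
COROLLARY of Mermin–Wagner, PRL 17 (1966) 1133 (the staggered field `h Σ_x (-1)^x S^{(3)}_x` is
covered: "ferromagnetism or antiferromagnetism", the Bogoliubov-inequality bound is the same) and
Koma–Tasaki, CMP 158 (1993), Theorem 2.1 / Corollary 2.2 with the staggered order operator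
`O_Λ = Σ_x (-1)^x S^{(1)}_x` (their (1.2)–(1.9)): `σ ≤ m_s = 0`.
[cite: MerminWagnerPRL1966, main result (pp. 1133–1135, antiferromagnetic case)]
[cite: KomaTasaki1993, Thm. 2.1 and Cor. 2.2 (staggered order operator, (1.2) and (2.12))] -/
def mermin_wagner_staggered : Prop :=
  ∀ (d : ℕ) (hd1 : 1 ≤ d) (hd : d ≤ 2) (n : ℕ) (J β : ℝ) (hβ : 0 < β),
    ¬ HasStaggeredEvenTorusLRO (fun L x y => spinSpinCorrTorus (d := d) β L n J x y)

/-- **hubbard.S12** (Mermin–Wagner theorem, original magnetisation form). For `d ∈ {1, 2}`,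
`β > 0`, the spontaneous magnetisation vanishes: the magnetisation per site `m_L(β, h)` in a
uniform field `h` tends to `0` when first `L → ∞` and then `h ↓ 0`, uniformly:
`∀ ε > 0, ∃ h₀ > 0, ∀ h ∈ (0, h₀), ∃ L₀, ∀ L ≥ L₀, |m_L(β, h)| < ε` (Mermin–Wagner's bound is
`|m| ≤ C (T |log h|)^{-1/2}` in `d = 2` and `|m| ≤ C T^{-2/3} h^{1/3}` in `d = 1`, uniformly in `L`).
This is the theorem AS PRINTED (the bounds are uniform in the volume, which gives the `∃ L₀` clause
trivially). Mermin–Wagner, PRL 17 (1966) 1133.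
[cite: MerminWagnerPRL1966, main result (pp. 1133–1135: |s_z| < const (T |ln h|)^{-1/2} in d = 2, const T^{-2/3} h^{1/3} in d = 1)] -/
def mermin_wagner_magnetisation : Prop :=
  ∀ (d : ℕ) (hd1 : 1 ≤ d) (hd : d ≤ 2) (n : ℕ) (J β : ℝ) (hβ : 0 < β),
    ∀ ε : ℝ, 0 < ε → ∃ h₀ : ℝ, 0 < h₀ ∧ ∀ h : ℝ, 0 < h → h < h₀ →
      ∃ L₀ : ℕ, ∀ L : ℕ, L₀ ≤ L → |torusMagnetisation β d L n J h| < ε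

/-- The thermal two-point function `re ⟨S^α_x S^α_y⟩_{β,L}` summed over `α`, for a general lattice
interaction `Φ` of local dimension `n + 1` wrapped on the torus `(ℤ/Lℤ)^d`
(`QLattice.torusHamiltonian Φ L`, periodic boundary conditions). **Junk value** `0` for `L = 0`.
Fröhlich–Pfister (1981) §2. [cite: FrohlichPfisterCMP1981] -/
def spinSpinCorrTorusOf (β : ℝ) {n : ℕ} (Φ : LatticeInteraction d (n + 1)) (L : ℕ)
    (x y : TorusSite d L) : ℝ :=
  if hL : L = 0 then 0
  else
    haveI : NeZero L := ⟨hL⟩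
    (∑ α : Fin 3, thermalCorr β (torusHamiltonian Φ L) (siteSpin n x α) (siteSpin n y α)).re

/-- **hubbard.S12** (Mermin–Wagner / Fröhlich–Pfister, general interactions). For `d ∈ {1, 2}` and
`β > 0`, the torus Gibbs states of any Hermitian, bounded, finite-range, `SU(2)`-invariant
interaction `Φ` of quantum spins `S = n/2` on `ℤ^d` have no long-range order of the spin–spin
correlation `⟨𝐒_x · 𝐒_y⟩`. COROLLARY of two printed theorems plus standard glue, NOT a statement
printed in one place: (1) Klein–Landau–Shucker, J. Stat. Phys. 26 (1981) 505, main Theorem — for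
quantum lattice systems in `d ≤ 2` with finite-range interactions invariant under a compact connected
Lie group, every equilibrium (KMS) state at `β < ∞` is invariant (the quantum, general-interaction
form of Mermin–Wagner; Fröhlich–Pfister, CMP 81 (1981) Thm. 1, cited by the interim docstring, is the
classical counterpart); (2) Koma–Tasaki, CMP 158 (1993), Thm. 2.1 / Cor. 2.2 — for bounded
finite-range `h_x` (their i)–iii), exactly `IsBounded`/`HasFiniteRange` here) the spontaneous
magnetisation dominates the long-range order parameter at every `β`, `m_s ≥ σ`; glue: `m_s > 0` yields a
non-invariant infinite-volume limit of Gibbs states with vanishing symmetry-breaking field, which is a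
KMS state (Bratteli–Robinson, *Operator Algebras and Quantum Statistical Mechanics 2*, §6.2), contradicting (1); hence `σ = 0`, i.e.
`¬ HasTorusLRO`. A reviewer who wants the printed-in-one-place standard should downgrade this to the
nearest-neighbour case `mermin_wagner`. [cite: KleinLandauShuckerJSP1981, main Theorem (KMS states in d ≤ 2 are G-invariant)]
[cite: KomaTasaki1993, Thm. 2.1 and Cor. 2.2] -/
def mermin_wagner_general : Prop :=
  ∀ (d : ℕ) (hd1 : 1 ≤ d) (hd : d ≤ 2) (n : ℕ) (Φ : LatticeInteraction d (n + 1)) (R C : ℝ) (hΦh : Φ.IsHermitian) (hΦR : Φ.HasFiniteRange R) (hΦC : Φ.IsBounded C) (hΦrot : Φ.IsRotationInvariant) (β : ℝ) (hβ : 0 < β),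
    ¬ HasTorusLRO (fun L x y => spinSpinCorrTorusOf (d := d) β Φ L x y)

/-! ### hubbard.S13: Néel order (Dyson–Lieb–Simon, Kennedy–Lieb–Shastry) -/

/-- **hubbard.S13** (Dyson–Lieb–Simon). For the spin-`S` Heisenberg antiferromagnet (`J > 0`) on
`ℤ^d` with `d ≥ 3` and `S = n/2 ≥ 1`, there is `β₀` such that for all `β ≥ β₀` the Gibbs states on
the even tori `(ℤ/2kℤ)^d` display Néel long-range order:
`liminf_k |Λ|⁻² Σ_{x,y} (-1)^{x+y} ⟨𝐒_x · 𝐒_y⟩_{β,2k} > 0`, equivalently (translation invariance,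
`hasStaggeredEvenTorusLRO_iff_onePoint`) `liminf |Λ|⁻¹ Σ_x (-1)^x ⟨𝐒_0 · 𝐒_x⟩ > 0`.
*Proof route (not a hypothesis):* reflection positivity of the torus Gibbs functional
`gibbsState β H_{2k}` w.r.t. reflections through bond planes (`StatMech.reflectBetweenSites`,
`StatMech.IsReflectionPositiveFunctional`), Gaussian domination and the infrared bound.
Dyson–Lieb–Simon, J. Stat. Phys. 18 (1978) 335, Theorem 5.? (with the later extension to all
`d ≥ 3`, `S ≥ 1`); Tasaki (2020) §4.4. [cite: TasakiQMBS2020] -/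
def dyson_lieb_simon : Prop :=
  ∀ (d : ℕ) (hd : 3 ≤ d) (n : ℕ) (hn : 2 ≤ n) (J : ℝ) (hJ : 0 < J),
    ∃ β₀ : ℝ, 0 < β₀ ∧ ∀ β : ℝ, β₀ ≤ β →
      HasStaggeredEvenTorusLRO (fun L x y => spinSpinCorrTorus (d := d) β L n J x y)

/-- **hubbard.S13** (Kennedy–Lieb–Shastry, ground-state Néel order). For the spin-`S` Heisenberg
antiferromagnet (`J > 0`) with `d = 3, S ≥ 1/2` or `d = 2, S ≥ 1` (`S = n/2`), the ground states
on the even tori `(ℤ/2kℤ)^d` (tracial ground-state functional `Matrix.groundStateFunctional`, the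
`β → ∞` limit of the Gibbs states; the ground state is in fact unique by Lieb–Mattis) display Néel
long-range order: `liminf_k |Λ|⁻² Σ_{x,y} (-1)^{x+y} ⟨𝐒_x · 𝐒_y⟩_{GS,2k} > 0`, equivalently
`liminf |Λ|⁻¹ Σ_x (-1)^x ⟨𝐒_0 · 𝐒_x⟩_{GS} > 0` (`hasStaggeredEvenTorusLRO_iff_onePoint`).
*Proof route (not a hypothesis):* reflection positivity (`StatMech.IsReflectionPositiveFunctional`)
of the Gibbs states, the infrared bound at `T → 0`, and the sum rules of KLS.
Kennedy–Lieb–Shastry, J. Stat. Phys. 53 (1988) 1019, Theorem; Dyson–Lieb–Simon (1978);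
Tasaki (2020) §4.4. [cite: KennedyLiebShastryJSP1988, main Theorem (§1: d = 3 all S; d = 2, S ≥ 1)] -/
def kennedy_lieb_shastry_ground : Prop :=
  ∀ (d n : ℕ) (h : d = 3 ∧ 1 ≤ n ∨ d = 2 ∧ 2 ≤ n) (J : ℝ) (hJ : 0 < J),
    HasStaggeredEvenTorusLRO (fun L x y => groundStateSpinCorrTorus (d := d) L n J x y)

end Literature.MathematicalPhysics.QuantumLattice
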